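import Mathlib
import Summits.Ventures.PercRepro2.K5StarCertDefs
import Summits.Ventures.PercRepro2.K5HyperCoeffs
import Summits.Ventures.PercRepro2.K5TypedK3
import Summits.Ventures.PercRepro2.TypedStarGroups

/-!
# FROM THE DIGIT CERTIFICATES TO THE PIECES, I: THE DICTIONARY AND THE ENCODINGS (blind cell
PercRepro2, p2 g2 / g5, 2026-08-25; the `K₃` analogue of typer-1's K5HyperCoeffs / K5HyperTheorem
bridge — the first half of p2 g2's K5StarBridge.lean, split for the olean lane: this half imports
served modules only; `cPosOn3b` / `cNegOn3b` carry the marking `b` — typer-1's K5HyperCoeffs3 holds the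
unparametrised `cPosOn3` / `cNegOn3` of the distinct marking)

A masked typed count of the crux kernel on `K₅` at the marking `(0, 1, 2, 3, b)` is the signed masked
triple count of its profile (`mcount_eq`: `K3_apply` through the masks + `typedCount_tables`); the
Kronecker numbers `posOn3b b` / `negOn3b b` encode those counts (`posOn3b_eq`, `negOn3b_eq`, by
`kron3_mul_mul`); the placement sums `sumT1 / sumT2 / sumM / sumB` encode the coefficient sums
`cSumT1 / cSumT2 / cSumM / cSumB` of the pieces (`sumT1_pos_eq` …), which are below `KB3 = 2^23`
(at most `60 · 3^10` per digit: `cSumT1_lt`, `cSumT2_lt`, `cSumM_le`, `cSumB_le`).  Part II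
(K5StarBridge.lean) turns a `CertLE` certificate into the nonnegativity of a piece.

Own code; standard axioms.
-/

namespace Summit.Ventures.PercRepro2

open Hub

namespace K5

/-! ## The masked coefficient counts of `K₃` -/

section Coeffs

/-- The positive masked triple counts of `K₃` at the marking `(0, 1, 2, 3, b)`. -/
def cPosOn3b (b : ℕ) (S₁ S₂ S₃ : Fin 10 → Bool) (k : Fin 10 → Fin 4) : ℕ :=
  cOn tPD tQ (t4p b) S₁ S₂ S₃ k + cOn tQ tPDoU (t5p b) S₁ S₂ S₃ k + cOn tPD tQ (t6m b) S₁ S₂ S₃ k +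
    cOn tPD (t7p b) (t7m 0) S₁ S₂ S₃ k + cOn tPD (t7m b) (t7p 0) S₁ S₂ S₃ k +
    cOn tPDoU (t7p b) (t7m 3) S₁ S₂ S₃ k + cOn tPDoU (t7m b) (t7p 3) S₁ S₂ S₃ k +
    cOn tPD (t7p b) t10p S₁ S₂ S₃ k + cOn tPD (t7m b) t10m S₁ S₂ S₃ k +
    cOn tQ (t12 b) tPDoU S₁ S₂ S₃ k

/-- The negative masked triple counts of `K₃` at the marking `(0, 1, 2, 3, b)`. -/
def cNegOn3b (b : ℕ) (S₁ S₂ S₃ : Fin 10 → Bool) (k : Fin 10 → Fin 4) : ℕ :=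
  cOn tPD tQ (t4m b) S₁ S₂ S₃ k + cOn tQ tPDoU (t5m b) S₁ S₂ S₃ k + cOn tPD tQ (t6p b) S₁ S₂ S₃ k +
    cOn tPD (t7p b) (t7p 0) S₁ S₂ S₃ k + cOn tPD (t7m b) (t7m 0) S₁ S₂ S₃ k +
    cOn tPDoU (t7p b) (t7p 3) S₁ S₂ S₃ k + cOn tPDoU (t7m b) (t7m 3) S₁ S₂ S₃ k +
    cOn tPD (t7p b) t10m S₁ S₂ S₃ k + cOn tPD (t7m b) t10p S₁ S₂ S₃ k +
    cOn tPD tQ (t11 b) S₁ S₂ S₃ k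

/-- Ten Kronecker sums in base `KB3` combine. -/
lemma sum_add_mul10_3 (f₁ f₂ f₃ f₄ f₅ f₆ f₇ f₈ f₉ f₁₀ : (Fin 10 → Fin 4) → ℕ) :
    ∑ k, f₁ k * KB3 ^ idx4 k + ∑ k, f₂ k * KB3 ^ idx4 k + ∑ k, f₃ k * KB3 ^ idx4 k +
      ∑ k, f₄ k * KB3 ^ idx4 k + ∑ k, f₅ k * KB3 ^ idx4 k + ∑ k, f₆ k * KB3 ^ idx4 k +
      ∑ k, f₇ k * KB3 ^ idx4 k + ∑ k, f₈ k * KB3 ^ idx4 k + ∑ k, f₉ k * KB3 ^ idx4 k +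
      ∑ k, f₁₀ k * KB3 ^ idx4 k =
      ∑ k, (f₁ k + f₂ k + f₃ k + f₄ k + f₅ k + f₆ k + f₇ k + f₈ k + f₉ k + f₁₀ k) * KB3 ^ idx4 k := by
  simp only [← Finset.sum_add_distrib]
  exact Finset.sum_congr rfl fun k _ => by ring

/-- `posOn3b b` encodes `cPosOn3b b`. -/
lemma posOn3b_eq (b : ℕ) (S₁ S₂ S₃ : Fin 10 → Bool) :
    posOn3b b S₁ S₂ S₃ = ∑ k, cPosOn3b b S₁ S₂ S₃ k * KB3 ^ idx4 k := by
  unfold posOn3b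
  simp only [kron3_mul_mul]
  rw [sum_add_mul10_3]
  rfl

/-- `negOn3b b` encodes `cNegOn3b b`. -/
lemma negOn3b_eq (b : ℕ) (S₁ S₂ S₃ : Fin 10 → Bool) :
    negOn3b b S₁ S₂ S₃ = ∑ k, cNegOn3b b S₁ S₂ S₃ k * KB3 ^ idx4 k := by
  unfold negOn3b
  simp only [kron3_mul_mul]
  rw [sum_add_mul10_3]
  rfl

/-- The masked counts are at most `10 · 3^10`. -/
lemma cPosOn3b_le (b : ℕ) (S₁ S₂ S₃ : Fin 10 → Bool) (k : Fin 10 → Fin 4) :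
    cPosOn3b b S₁ S₂ S₃ k ≤ 10 * 59049 := by
  unfold cPosOn3b
  have := cOn_le tPD tQ (t4p b) S₁ S₂ S₃ k
  have := cOn_le tQ tPDoU (t5p b) S₁ S₂ S₃ k
  have := cOn_le tPD tQ (t6m b) S₁ S₂ S₃ k
  have := cOn_le tPD (t7p b) (t7m 0) S₁ S₂ S₃ k
  have := cOn_le tPD (t7m b) (t7p 0) S₁ S₂ S₃ k
  have := cOn_le tPDoU (t7p b) (t7m 3) S₁ S₂ S₃ k
  have := cOn_le tPDoU (t7m b) (t7p 3) S₁ S₂ S₃ k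
  have := cOn_le tPD (t7p b) t10p S₁ S₂ S₃ k
  have := cOn_le tPD (t7m b) t10m S₁ S₂ S₃ k
  have := cOn_le tQ (t12 b) tPDoU S₁ S₂ S₃ k
  omega

/-- The masked counts are at most `10 · 3^10`. -/
lemma cNegOn3b_le (b : ℕ) (S₁ S₂ S₃ : Fin 10 → Bool) (k : Fin 10 → Fin 4) :
    cNegOn3b b S₁ S₂ S₃ k ≤ 10 * 59049 := by
  unfold cNegOn3b
  have := cOn_le tPD tQ (t4m b) S₁ S₂ S₃ k
  have := cOn_le tQ tPDoU (t5m b) S₁ S₂ S₃ k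
  have := cOn_le tPD tQ (t6p b) S₁ S₂ S₃ k
  have := cOn_le tPD (t7p b) (t7p 0) S₁ S₂ S₃ k
  have := cOn_le tPD (t7m b) (t7m 0) S₁ S₂ S₃ k
  have := cOn_le tPDoU (t7p b) (t7p 3) S₁ S₂ S₃ k
  have := cOn_le tPDoU (t7m b) (t7m 3) S₁ S₂ S₃ k
  have := cOn_le tPD (t7p b) t10m S₁ S₂ S₃ k
  have := cOn_le tPD (t7m b) t10p S₁ S₂ S₃ k
  have := cOn_le tPD tQ (t11 b) S₁ S₂ S₃ k
  omega

end Coeffs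

/-! ## The dictionary: masked typed counts are signed masked triple counts -/

section Dictionary

variable {R : Type*} [Field R]

/-- **A masked typed count of `K₃` on `K₅` is the signed masked triple count of its profile.** -/
lemma mcount_eq (b : Fin 5) (F : Finset (Fin 10)) (z : Config (Fin 10)) (τ : Fin 10 → ℕ)
    (k : Fin 10 → Fin 4) (hk : ∀ e, (k e : ℕ) = if e ∈ F then τ e else if z e then 3 else 0)
    (S₁ S₂ S₃ : Fin 10 → Bool) :
    mcount F z τ S₁ S₂ S₃ (CovForm.K3 (R := R) ends5 0 1 2 3 b) =
      ((cPosOn3b b S₁ S₂ S₃ k : ℕ) : R) - ((cNegOn3b b S₁ S₂ S₃ k : ℕ) : R) := by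
  unfold mcount
  have hK : (fun x y w => CovForm.K3 (R := R) ends5 0 1 2 3 b (orOn S₁ x) (orOn S₂ y) (orOn S₃ w)) =
      fun x y w =>
      (indR (fun ω => tPD (orOn S₁ ω)) x * indR (fun ω => tQ (orOn S₂ ω)) y * indR (fun ω => t4p b (orOn S₃ ω)) w +
        indR (fun ω => tQ (orOn S₁ ω)) x * indR (fun ω => tPDoU (orOn S₂ ω)) y * indR (fun ω => t5p b (orOn S₃ ω)) w +
        indR (fun ω => tPD (orOn S₁ ω)) x * indR (fun ω => tQ (orOn S₂ ω)) y * indR (fun ω => t6m b (orOn S₃ ω)) w +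
        indR (fun ω => tPD (orOn S₁ ω)) x * indR (fun ω => t7p b (orOn S₂ ω)) y * indR (fun ω => t7m 0 (orOn S₃ ω)) w +
        indR (fun ω => tPD (orOn S₁ ω)) x * indR (fun ω => t7m b (orOn S₂ ω)) y * indR (fun ω => t7p 0 (orOn S₃ ω)) w +
        indR (fun ω => tPDoU (orOn S₁ ω)) x * indR (fun ω => t7p b (orOn S₂ ω)) y * indR (fun ω => t7m 3 (orOn S₃ ω)) w +
        indR (fun ω => tPDoU (orOn S₁ ω)) x * indR (fun ω => t7m b (orOn S₂ ω)) y * indR (fun ω => t7p 3 (orOn S₃ ω)) w +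
        indR (fun ω => tPD (orOn S₁ ω)) x * indR (fun ω => t7p b (orOn S₂ ω)) y * indR (fun ω => t10p (orOn S₃ ω)) w +
        indR (fun ω => tPD (orOn S₁ ω)) x * indR (fun ω => t7m b (orOn S₂ ω)) y * indR (fun ω => t10m (orOn S₃ ω)) w +
        indR (fun ω => tQ (orOn S₁ ω)) x * indR (fun ω => t12 b (orOn S₂ ω)) y * indR (fun ω => tPDoU (orOn S₃ ω)) w) -
      (indR (fun ω => tPD (orOn S₁ ω)) x * indR (fun ω => tQ (orOn S₂ ω)) y * indR (fun ω => t4m b (orOn S₃ ω)) w +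
        indR (fun ω => tQ (orOn S₁ ω)) x * indR (fun ω => tPDoU (orOn S₂ ω)) y * indR (fun ω => t5m b (orOn S₃ ω)) w +
        indR (fun ω => tPD (orOn S₁ ω)) x * indR (fun ω => tQ (orOn S₂ ω)) y * indR (fun ω => t6p b (orOn S₃ ω)) w +
        indR (fun ω => tPD (orOn S₁ ω)) x * indR (fun ω => t7p b (orOn S₂ ω)) y * indR (fun ω => t7p 0 (orOn S₃ ω)) w +
        indR (fun ω => tPD (orOn S₁ ω)) x * indR (fun ω => t7m b (orOn S₂ ω)) y * indR (fun ω => t7m 0 (orOn S₃ ω)) w +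
        indR (fun ω => tPDoU (orOn S₁ ω)) x * indR (fun ω => t7p b (orOn S₂ ω)) y * indR (fun ω => t7p 3 (orOn S₃ ω)) w +
        indR (fun ω => tPDoU (orOn S₁ ω)) x * indR (fun ω => t7m b (orOn S₂ ω)) y * indR (fun ω => t7m 3 (orOn S₃ ω)) w +
        indR (fun ω => tPD (orOn S₁ ω)) x * indR (fun ω => t7p b (orOn S₂ ω)) y * indR (fun ω => t10m (orOn S₃ ω)) w +
        indR (fun ω => tPD (orOn S₁ ω)) x * indR (fun ω => t7m b (orOn S₂ ω)) y * indR (fun ω => t10p (orOn S₃ ω)) w +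
        indR (fun ω => tPD (orOn S₁ ω)) x * indR (fun ω => tQ (orOn S₂ ω)) y * indR (fun ω => t11 b (orOn S₃ ω)) w) := by
    funext x y w
    exact K3_apply b (orOn S₁ x) (orOn S₂ y) (orOn S₃ w)
  rw [hK, typedCount_sub]
  simp only [typedCount_add, typedCount_tables F z τ k hk]
  unfold cPosOn3b cNegOn3b cOn
  push_cast
  ring

/-- A typed count vanishes when a typed edge has type above `3`. -/
lemma typedCount_eq_zero_of_gt3 (F : Finset (Fin 10)) (z : Config (Fin 10)) (τ : Fin 10 → ℕ)
    (hτ : ¬ ∀ e ∈ F, τ e ≤ 3) (K : Config (Fin 10) → Config (Fin 10) → Config (Fin 10) → R) :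
    typedCount F z τ K = 0 := by
  unfold typedCount
  refine Finset.sum_eq_zero fun x _ => Finset.sum_eq_zero fun y _ =>
    Finset.sum_eq_zero fun w _ => ?_
  rw [if_neg]
  rintro ⟨-, h2⟩
  apply hτ
  intro e he
  rw [← h2 e he]
  unfold openCount
  have := Bool.toNat_le (x e)
  have := Bool.toNat_le (y e)
  have := Bool.toNat_le (w e)
  omega

end Dictionary

/-! ## The encodings of the coefficient sums -/

section Encodings

/-- The coefficient sum of `sumT1`. -/
def cSumT1 (c : (Fin 10 → Bool) → (Fin 10 → Bool) → (Fin 10 → Bool) → (Fin 10 → Fin 4) → ℕ)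
    (D : Fin 10 → Bool) (k : Fin 10 → Fin 4) : ℕ :=
  c D mNone mNone k + c mNone D mNone k + c mNone mNone D k

/-- The coefficient sum of `sumT2`. -/
def cSumT2 (c : (Fin 10 → Bool) → (Fin 10 → Bool) → (Fin 10 → Bool) → (Fin 10 → Fin 4) → ℕ)
    (D : Fin 10 → Bool) (k : Fin 10 → Fin 4) : ℕ :=
  c D D mNone k + c D mNone D k + c mNone D D k

/-- The coefficient sum of `sumM`. -/
def cSumM (c : (Fin 10 → Bool) → (Fin 10 → Bool) → (Fin 10 → Bool) → (Fin 10 → Fin 4) → ℕ)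
    (D S : Fin 10 → Bool) (k : Fin 10 → Fin 4) : ℕ :=
  c D S mNone k + c D mNone S k + c S D mNone k + c mNone D S k + c S mNone D k + c mNone S D k

/-- The coefficient sum of `sumB`. -/
def cSumB (c : (Fin 10 → Bool) → (Fin 10 → Bool) → (Fin 10 → Bool) → (Fin 10 → Fin 4) → ℕ)
    (S₁ S₂ S₃ : Fin 10 → Bool) (k : Fin 10 → Fin 4) : ℕ :=
  c S₁ S₂ S₃ k + c S₁ S₃ S₂ k + c S₂ S₁ S₃ k + c S₂ S₃ S₁ k + c S₃ S₁ S₂ k + c S₃ S₂ S₁ k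

/-- Three encodings add. -/
lemma sum_add_mul3_3 (f₁ f₂ f₃ : (Fin 10 → Fin 4) → ℕ) :
    ∑ k, f₁ k * KB3 ^ idx4 k + ∑ k, f₂ k * KB3 ^ idx4 k + ∑ k, f₃ k * KB3 ^ idx4 k =
      ∑ k, (f₁ k + f₂ k + f₃ k) * KB3 ^ idx4 k := by
  simp only [← Finset.sum_add_distrib]
  exact Finset.sum_congr rfl fun k _ => by ring

/-- Six encodings add. -/
lemma sum_add_mul6_3 (f₁ f₂ f₃ f₄ f₅ f₆ : (Fin 10 → Fin 4) → ℕ) :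
    ∑ k, f₁ k * KB3 ^ idx4 k + ∑ k, f₂ k * KB3 ^ idx4 k + ∑ k, f₃ k * KB3 ^ idx4 k +
      ∑ k, f₄ k * KB3 ^ idx4 k + ∑ k, f₅ k * KB3 ^ idx4 k + ∑ k, f₆ k * KB3 ^ idx4 k =
      ∑ k, (f₁ k + f₂ k + f₃ k + f₄ k + f₅ k + f₆ k) * KB3 ^ idx4 k := by
  simp only [← Finset.sum_add_distrib]
  exact Finset.sum_congr rfl fun k _ => by ring

/-- Two encodings add. -/
lemma sum_add_mul2_3 (f₁ f₂ : (Fin 10 → Fin 4) → ℕ) :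
    ∑ k, f₁ k * KB3 ^ idx4 k + ∑ k, f₂ k * KB3 ^ idx4 k = ∑ k, (f₁ k + f₂ k) * KB3 ^ idx4 k := by
  simp only [← Finset.sum_add_distrib]
  exact Finset.sum_congr rfl fun k _ => by ring

/-- `sumT1 (posOn3b b)` encodes `cSumT1 (cPosOn3b b)`. -/
lemma sumT1_pos_eq (b : ℕ) (D : Fin 10 → Bool) :
    sumT1 (posOn3b b) D = ∑ k, cSumT1 (cPosOn3b b) D k * KB3 ^ idx4 k := by
  unfold sumT1; simp only [posOn3b_eq]; rw [sum_add_mul3_3]; rfl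

/-- `sumT1 (negOn3b b)` encodes `cSumT1 (cNegOn3b b)`. -/
lemma sumT1_neg_eq (b : ℕ) (D : Fin 10 → Bool) :
    sumT1 (negOn3b b) D = ∑ k, cSumT1 (cNegOn3b b) D k * KB3 ^ idx4 k := by
  unfold sumT1; simp only [negOn3b_eq]; rw [sum_add_mul3_3]; rfl

/-- `sumT2 (posOn3b b)` encodes `cSumT2 (cPosOn3b b)`. -/
lemma sumT2_pos_eq (b : ℕ) (D : Fin 10 → Bool) :
    sumT2 (posOn3b b) D = ∑ k, cSumT2 (cPosOn3b b) D k * KB3 ^ idx4 k := by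
  unfold sumT2; simp only [posOn3b_eq]; rw [sum_add_mul3_3]; rfl

/-- `sumT2 (negOn3b b)` encodes `cSumT2 (cNegOn3b b)`. -/
lemma sumT2_neg_eq (b : ℕ) (D : Fin 10 → Bool) :
    sumT2 (negOn3b b) D = ∑ k, cSumT2 (cNegOn3b b) D k * KB3 ^ idx4 k := by
  unfold sumT2; simp only [negOn3b_eq]; rw [sum_add_mul3_3]; rfl

/-- `sumM (posOn3b b)` encodes `cSumM (cPosOn3b b)`. -/
lemma sumM_pos_eq (b : ℕ) (D S : Fin 10 → Bool) :
    sumM (posOn3b b) D S = ∑ k, cSumM (cPosOn3b b) D S k * KB3 ^ idx4 k := by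
  unfold sumM; simp only [posOn3b_eq]; rw [sum_add_mul6_3]; rfl

/-- `sumM (negOn3b b)` encodes `cSumM (cNegOn3b b)`. -/
lemma sumM_neg_eq (b : ℕ) (D S : Fin 10 → Bool) :
    sumM (negOn3b b) D S = ∑ k, cSumM (cNegOn3b b) D S k * KB3 ^ idx4 k := by
  unfold sumM; simp only [negOn3b_eq]; rw [sum_add_mul6_3]; rfl

/-- `sumB (posOn3b b)` encodes `cSumB (cPosOn3b b)`. -/
lemma sumB_pos_eq (b : ℕ) (S₁ S₂ S₃ : Fin 10 → Bool) :
    sumB (posOn3b b) S₁ S₂ S₃ = ∑ k, cSumB (cPosOn3b b) S₁ S₂ S₃ k * KB3 ^ idx4 k := by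
  unfold sumB; simp only [posOn3b_eq]; rw [sum_add_mul6_3]; rfl

/-- `sumB (negOn3b b)` encodes `cSumB (cNegOn3b b)`. -/
lemma sumB_neg_eq (b : ℕ) (S₁ S₂ S₃ : Fin 10 → Bool) :
    sumB (negOn3b b) S₁ S₂ S₃ = ∑ k, cSumB (cNegOn3b b) S₁ S₂ S₃ k * KB3 ^ idx4 k := by
  unfold sumB; simp only [negOn3b_eq]; rw [sum_add_mul6_3]; rfl

/-- The coefficient bounds: below `KB3 = 2^23`. -/
lemma cSumT1_lt (b : ℕ) (D : Fin 10 → Bool) (k : Fin 10 → Fin 4) :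
    cSumT1 (cPosOn3b b) D k < KB3 ∧ cSumT1 (cNegOn3b b) D k < KB3 := by
  unfold cSumT1
  have := cPosOn3b_le b D mNone mNone k; have := cPosOn3b_le b mNone D mNone k
  have := cPosOn3b_le b mNone mNone D k; have := cNegOn3b_le b D mNone mNone k
  have := cNegOn3b_le b mNone D mNone k; have := cNegOn3b_le b mNone mNone D k
  rw [KB3_eq]; omega

/-- The coefficient bounds of `cSumT2`: below `KB3 = 2^23`. -/
lemma cSumT2_lt (b : ℕ) (D : Fin 10 → Bool) (k : Fin 10 → Fin 4) :
    cSumT2 (cPosOn3b b) D k < KB3 ∧ cSumT2 (cNegOn3b b) D k < KB3 := by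
  unfold cSumT2
  have := cPosOn3b_le b D D mNone k; have := cPosOn3b_le b D mNone D k
  have := cPosOn3b_le b mNone D D k; have := cNegOn3b_le b D D mNone k
  have := cNegOn3b_le b D mNone D k; have := cNegOn3b_le b mNone D D k
  rw [KB3_eq]; omega

/-- The six-term sums of masked counts are at most `60 · 3^10`. -/
lemma cSumM_le (c : ℕ → (Fin 10 → Bool) → (Fin 10 → Bool) → (Fin 10 → Bool) → (Fin 10 → Fin 4) → ℕ)
    (hc : ∀ b S₁ S₂ S₃ k, c b S₁ S₂ S₃ k ≤ 10 * 59049) (b : ℕ) (D S : Fin 10 → Bool)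
    (k : Fin 10 → Fin 4) : cSumM (c b) D S k ≤ 60 * 59049 := by
  unfold cSumM
  have := hc b D S mNone k; have := hc b D mNone S k; have := hc b S D mNone k
  have := hc b mNone D S k; have := hc b S mNone D k; have := hc b mNone S D k
  omega

/-- The six-term sums of masked counts are at most `60 · 3^10`. -/
lemma cSumB_le (c : ℕ → (Fin 10 → Bool) → (Fin 10 → Bool) → (Fin 10 → Bool) → (Fin 10 → Fin 4) → ℕ)
    (hc : ∀ b S₁ S₂ S₃ k, c b S₁ S₂ S₃ k ≤ 10 * 59049) (b : ℕ) (S₁ S₂ S₃ : Fin 10 → Bool)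
    (k : Fin 10 → Fin 4) : cSumB (c b) S₁ S₂ S₃ k ≤ 60 * 59049 := by
  unfold cSumB
  have := hc b S₁ S₂ S₃ k; have := hc b S₁ S₃ S₂ k; have := hc b S₂ S₁ S₃ k
  have := hc b S₂ S₃ S₁ k; have := hc b S₃ S₁ S₂ k; have := hc b S₃ S₂ S₁ k
  omega

end Encodings

end K5

end Summit.Ventures.PercRepro2
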